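import Mathlib
import Summits.NavierStokesRegularity.NavierStokesRegularity.Theorems.FilamentSkeletonRssSkeletonJ1RLiaDefectSelfArith

/-!
# Crux `SkeletonJ1R` (stmt-NavierStokesRegularity-23610) · line `streamline_kantorovich_R` · toward stub F2-d (`LiaDefectDerivBL`, v7),
# Γ-BOOKKEEPING ARITHMETIC OF B1′: the eight terms of `ℓ ×` the self-strand DERIVATIVE bound are each `≤ const · (√Γ + |τ|)/√log Γ`

Hand `leafhand-ns-filamentskeletonrs-1` (gen 1), `--supports stmt-NavierStokesRegularity-23610 --as helper`.  MODEL rung, NEGATIVE side of the ladder: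
pure real arithmetic (imports `Mathlib` and the B0 arithmetic file only) for a HYPOTHETICAL filament-type blow-up skeleton; nothing here is a claim about
Navier–Stokes regularity; the stub and the crux stay OPEN.

Dictionary (all reals, as in `…LiaDefectSelfArith`): `G = √Γ ≥ 1`, `L = log Γ`, `sL = √L` (`sL² = L`, `1 ≤ sL`), `u = √Γ + |τ|` (`G ≤ u`), `cΓ ≥ |Γγ_j/4π|`,
`b ≥ |β⁻¹|` with `cΓ·b = κ/L` and `b = 8π/(θp Γ L)`, collar scale `ℓ = Rb·G·sL` with the COLLAR FLOOR `ℓ ≤ Cs·u` (from `ℓ ≤ ‖x_jτ‖ ≤ Rwd√Γ + |τ|`),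
window `R = r₀G`, `2ℓ ≤ Lw`, third-derivative window data `H = b·hH`, `H′ = b·h′/G`, envelope parameters `κR = b kR u`, `κ0 = b(e₀+Q₀)u`, `ε₁ = b Q₀`,
and the inputs `(κR R)² ≤ (δ₀/sL)²`, `Λ ≤ L`, `log(Lw/R) ≤ 2Rb sL/r₀`, `κm ≤ b·km·G·sL`.
Lemmas `selfDerivTerm_T1` … `selfDerivTerm_T8` bound `ℓcΓ·16RH′`, `ℓcΓ·168Rκ_R H`, `ℓcΓ·8(κ_R R)²HΛ`, `ℓcΓ·72ε₁log(Lw/R)`, `ℓcΓ·72πκ₀/R`,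
`ℓcΓ·(64θ/Lw)(π/Lw)`, `ℓcΓ·8κm(π/Lw)`, `ℓ·cΓ(e²/R²)H` by explicit constants times `u/sL` — the terms of
`…LiaSelfDerivReference.IsLiaReference.selfDerivStrand_sub_lia_le` multiplied by `|Γγ_j/4π|·ℓ`, plus the Rosenhead-coefficient mismatch. [folklore]
-/

-- `dupNamespace` off: the module name repeats `NavierStokesRegularity` by the tree's `Summits/<S>/<S>/Theorems` layout (same as every sibling file).
set_option linter.dupNamespace false
-- `unusedTactic`/`unreachableTactic` off: the `first | (field_simp; ring) | field_simp` closers below are robust to how far `field_simp` normalises.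
set_option linter.unusedTactic false
set_option linter.unreachableTactic false

noncomputable section

namespace Summit.NavierStokesRegularity.NavierStokesRegularity.Theorems.SkeletonJ1RFrame

variable {cΓ b κ L sL G u Γ ℓ Rb : ℝ}

/-- Term 1′: `ℓcΓ·(16 R H′) ≤ κ·16 r₀ Rb h′ · u/sL` (`H′ = b h′/G`). [folklore] -/
theorem selfDerivTerm_T1 {R H' r₀ h' : ℝ} (hcb : cΓ * b = κ / L) (hsLL : sL ^ 2 = L) (hsL1 : 1 ≤ sL) (hG : 0 < G) (hGu : G ≤ u)
    (hκ : 0 ≤ κ) (hr₀ : 0 ≤ r₀) (hh' : 0 ≤ h') (hRb : 0 ≤ Rb) (hℓ : ℓ = Rb * G * sL) (hR : R = r₀ * G) (hH' : H' = b * h' / G) :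
    ℓ * cΓ * (16 * R * H') ≤ κ * (16 * r₀ * Rb * h') * (u / sL) := by
  have hL0 : 0 < L := by rw [← hsLL]; positivity
  have hsL0 : 0 < sL := by linarith
  have heq : ℓ * cΓ * (16 * R * H') = κ * (16 * r₀ * Rb * h') * (G / sL) := by
    rw [hℓ, hR, hH', show Rb * G * sL * cΓ * (16 * (r₀ * G) * (b * h' / G)) = (cΓ * b) * (16 * r₀ * Rb * h') * sL * (G * G / G) by ring,
      hcb, mul_div_assoc, div_self hG.ne', mul_one, ← hsLL]
    first | (field_simp; ring) | field_simp
  rw [heq]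
  exact mul_le_mul_of_nonneg_left (ratio_bounds hG.le hGu hsL1).2.2 (by positivity)

/-- Term 2′: `ℓcΓ·(168 R κ_R H) ≤ κ·1344π r₀ Rb kR hH/θp · u/sL` (`κ_R = b kR u`, `H = b hH`). [folklore] -/
theorem selfDerivTerm_T2 {R H κR r₀ kR hH θp : ℝ} (hcb : cΓ * b = κ / L) (hb : b = 8 * Real.pi / (θp * Γ * L)) (hsLL : sL ^ 2 = L)
    (hGG : G ^ 2 = Γ) (hsL1 : 1 ≤ sL) (hG : 0 < G) (hGu : G ≤ u) (hθp : 0 < θp) (hκ : 0 ≤ κ) (hr₀ : 0 ≤ r₀) (hkR : 0 ≤ kR)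
    (hhH : 0 ≤ hH) (hRb : 0 ≤ Rb) (hℓ : ℓ = Rb * G * sL) (hR : R = r₀ * G) (hκR : κR = b * kR * u) (hHd : H = b * hH) :
    ℓ * cΓ * (168 * R * (κR * H)) ≤ κ * (1344 * Real.pi * r₀ * Rb * kR * hH / θp) * (u / sL) := by
  have hL0 : 0 < L := by rw [← hsLL]; positivity
  have hsL0 : 0 < sL := by linarith
  have hΓ : 0 < Γ := by rw [← hGG]; positivity
  have hu0 : 0 ≤ u := hG.le.trans hGu
  have heq : ℓ * cΓ * (168 * R * (κR * H)) = κ * (1344 * Real.pi * r₀ * Rb * kR * hH / θp) * (u / sL ^ 3) := by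
    rw [hℓ, hR, hκR, hHd, show Rb * G * sL * cΓ * (168 * (r₀ * G) * (b * kR * u * (b * hH))) =
      (cΓ * b) * b * (168 * r₀ * Rb * kR * hH) * G ^ 2 * sL * u by ring, hcb, hb, hGG, ← hsLL]
    first | (field_simp; ring) | field_simp
  rw [heq]
  have hcube : u / sL ^ 3 ≤ u / sL :=
    div_le_div_of_nonneg_left hu0 hsL0 (by nlinarith [pow_le_pow_right₀ hsL1 (show 1 ≤ 3 by norm_num)])
  exact mul_le_mul_of_nonneg_left hcube (by positivity)

/-- Term 3′: `ℓcΓ·8(κ_R R)² H Λ ≤ κ·8δ₀² hH Rb · u/sL` (`(κ_R R)² ≤ (δ₀/sL)²`, `0 ≤ Λ ≤ L`, `H = b hH`). [folklore] -/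
theorem selfDerivTerm_T3 {R H κR δ₀ Λ hH : ℝ} (hcb : cΓ * b = κ / L) (hsLL : sL ^ 2 = L) (hsL1 : 1 ≤ sL) (hG : 0 < G) (hGu : G ≤ u)
    (hκ : 0 ≤ κ) (hcΓ : 0 ≤ cΓ) (hb0 : 0 ≤ b) (hhH : 0 ≤ hH) (hRb : 0 ≤ Rb) (hκRR : (κR * R) ^ 2 ≤ (δ₀ / sL) ^ 2) (hΛ0 : 0 ≤ Λ)
    (hΛL : Λ ≤ L) (hℓ : ℓ = Rb * G * sL) (hHd : H = b * hH) :
    ℓ * cΓ * (8 * (κR * R) ^ 2 * H * Λ) ≤ κ * (8 * δ₀ ^ 2 * hH * Rb) * (u / sL) := by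
  have hL0 : 0 < L := by rw [← hsLL]; positivity
  have hsL0 : 0 < sL := by linarith
  have hℓ0 : 0 ≤ ℓ := by rw [hℓ]; positivity
  have hH0 : 0 ≤ H := by rw [hHd]; positivity
  calc ℓ * cΓ * (8 * (κR * R) ^ 2 * H * Λ) ≤ ℓ * cΓ * (8 * (δ₀ / sL) ^ 2 * H * L) := by gcongr
    _ = κ * (8 * δ₀ ^ 2 * hH * Rb) * (G / sL) := by
        rw [hℓ, hHd, show Rb * G * sL * cΓ * (8 * (δ₀ / sL) ^ 2 * (b * hH) * L) = (cΓ * b) * (8 * δ₀ ^ 2 * hH * Rb) * G * L * sL / sL ^ 2 by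
          first | (field_simp; ring) | field_simp, hcb, ← hsLL]
        first | (field_simp; ring) | field_simp
    _ ≤ κ * (8 * δ₀ ^ 2 * hH * Rb) * (u / sL) := mul_le_mul_of_nonneg_left (ratio_bounds hG.le hGu hsL1).2.2 (by positivity)

/-- Term 4′: `ℓcΓ·72 ε₁ log(Lw/R) ≤ κ·144 Q₀ Rb Cs/r₀ · u/sL` — the one place the COLLAR FLOOR `ℓ ≤ Cs·u` is spent (`ε₁ = b Q₀`). [folklore] -/
theorem selfDerivTerm_T4 {ε₁ Q₀ r₀ lg Cs : ℝ} (hcb : cΓ * b = κ / L) (hsLL : sL ^ 2 = L) (hsL1 : 1 ≤ sL) (hG : 0 < G)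
    (hκ : 0 ≤ κ) (hcΓ : 0 ≤ cΓ) (hb0 : 0 ≤ b) (hQ₀ : 0 ≤ Q₀) (hr₀ : 0 < r₀) (hRb : 0 ≤ Rb) (hlg : lg ≤ 2 * Rb * sL / r₀)
    (hℓ : ℓ = Rb * G * sL) (hℓu : Rb * G * sL ≤ Cs * u) (hε₁ : ε₁ = b * Q₀) :
    ℓ * cΓ * (72 * ε₁ * lg) ≤ κ * (144 * Q₀ * Rb * Cs / r₀) * (u / sL) := by
  have hL0 : 0 < L := by rw [← hsLL]; positivity
  have hsL0 : 0 < sL := by linarith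
  have hℓ0 : 0 ≤ ℓ := by rw [hℓ]; positivity
  have hε₁0 : 0 ≤ ε₁ := by rw [hε₁]; positivity
  calc ℓ * cΓ * (72 * ε₁ * lg) ≤ ℓ * cΓ * (72 * ε₁ * (2 * Rb * sL / r₀)) := by gcongr
    _ = (κ * (144 * Q₀ * Rb / r₀) / sL) * (Rb * G * sL) := by
        rw [hℓ, hε₁, show Rb * G * sL * cΓ * (72 * (b * Q₀) * (2 * Rb * sL / r₀)) = (cΓ * b) * (144 * Q₀ * Rb / r₀) * sL * (Rb * G * sL) by ring,
          hcb, ← hsLL]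
        first | (field_simp; ring) | field_simp
    _ ≤ (κ * (144 * Q₀ * Rb / r₀) / sL) * (Cs * u) := mul_le_mul_of_nonneg_left hℓu (by positivity)
    _ = κ * (144 * Q₀ * Rb * Cs / r₀) * (u / sL) := by first | (field_simp; ring) | field_simp

/-- Term 5′: `ℓcΓ·72π κ₀/R ≤ κ·72π Rb (e₀+Q₀)/r₀ · u/sL` (`κ₀ = b(e₀+Q₀)u`, `R = r₀G`). [folklore] -/
theorem selfDerivTerm_T5 {R κ0 e₀ Q₀ r₀ : ℝ} (hcb : cΓ * b = κ / L) (hsLL : sL ^ 2 = L) (hsL1 : 1 ≤ sL) (hG : 0 < G)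
    (hr₀ : 0 < r₀) (hℓ : ℓ = Rb * G * sL) (hR : R = r₀ * G) (hκ0 : κ0 = b * (e₀ + Q₀) * u) :
    ℓ * cΓ * (72 * Real.pi * κ0 / R) ≤ κ * (72 * Real.pi * Rb * (e₀ + Q₀) / r₀) * (u / sL) := by
  have hL0 : 0 < L := by rw [← hsLL]; positivity
  have hsL0 : 0 < sL := by linarith
  refine le_of_eq ?_
  rw [hℓ, hR, hκ0, show Rb * G * sL * cΓ * (72 * Real.pi * (b * (e₀ + Q₀) * u) / (r₀ * G)) =
    (cΓ * b) * (72 * Real.pi * Rb * (e₀ + Q₀)) * sL * u * G / (r₀ * G) by ring, hcb, ← hsLL]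
  first | (field_simp; ring) | field_simp

/-- Term 6′: `ℓcΓ·(64θ/Lw)(π/Lw) ≤ 4/(θp Rb) · u/sL` (`cΓ = Γ/(4πθp)`, `0 ≤ θ ≤ 1`, `2ℓ ≤ Lw`, `ℓ = Rb G sL`). [folklore] -/
theorem selfDerivTerm_T6 {θ Lw θp : ℝ} (hcΓ : cΓ = Γ / (4 * Real.pi * θp)) (hGG : G ^ 2 = Γ) (hsL1 : 1 ≤ sL) (hG : 0 < G) (hGu : G ≤ u)
    (hθp : 0 < θp) (hRb : 0 < Rb) (hθ1 : θ ≤ 1) (hℓ : ℓ = Rb * G * sL) (hLw : 2 * ℓ ≤ Lw) :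
    ℓ * cΓ * (64 * θ / Lw * (Real.pi / Lw)) ≤ 4 / (θp * Rb) * (u / sL) := by
  have hsL0 : 0 < sL := by linarith
  have hℓ0 : 0 < ℓ := by rw [hℓ]; positivity
  have hLw0 : 0 < Lw := by linarith
  have hΓ : 0 < Γ := by rw [← hGG]; positivity
  have hcΓ0 : 0 ≤ cΓ := by rw [hcΓ]; positivity
  have h1 : 64 * θ / Lw * (Real.pi / Lw) ≤ 64 * Real.pi / (2 * ℓ) ^ 2 := by
    rw [div_mul_div_comm, div_le_div_iff₀ (by positivity) (by positivity)]
    have h2 : (2 * ℓ) ^ 2 ≤ Lw * Lw := by nlinarith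
    calc 64 * θ * Real.pi * (2 * ℓ) ^ 2 ≤ 64 * 1 * Real.pi * (2 * ℓ) ^ 2 := by gcongr
      _ ≤ 64 * Real.pi * (Lw * Lw) := by nlinarith [Real.pi_pos]
  calc ℓ * cΓ * (64 * θ / Lw * (Real.pi / Lw)) ≤ ℓ * cΓ * (64 * Real.pi / (2 * ℓ) ^ 2) := by gcongr
    _ = 4 / (θp * Rb) * (G / sL) := by rw [hℓ, hcΓ, ← hGG]; first | (field_simp; ring) | field_simp
    _ ≤ 4 / (θp * Rb) * (u / sL) := mul_le_mul_of_nonneg_left (ratio_bounds hG.le hGu hsL1).2.2 (by positivity)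

/-- Term 7′: `ℓcΓ·8κm(π/Lw) ≤ κ·4π km · u/sL` (`κm ≤ b·km·G·sL`, `2ℓ ≤ Lw`). [folklore] -/
theorem selfDerivTerm_T7 {κm km Lw : ℝ} (hcb : cΓ * b = κ / L) (hsLL : sL ^ 2 = L) (hsL1 : 1 ≤ sL) (hG : 0 < G) (hGu : G ≤ u)
    (hκ : 0 ≤ κ) (hcΓ : 0 ≤ cΓ) (hb0 : 0 ≤ b) (hkm : 0 ≤ km) (hκm : κm ≤ b * km * G * sL) (hRb : 0 < Rb)
    (hℓ : ℓ = Rb * G * sL) (hLw : 2 * ℓ ≤ Lw) :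
    ℓ * cΓ * (8 * κm * (Real.pi / Lw)) ≤ κ * (4 * Real.pi * km) * (u / sL) := by
  have hL0 : 0 < L := by rw [← hsLL]; positivity
  have hsL0 : 0 < sL := by linarith
  have hℓ0 : 0 < ℓ := by rw [hℓ]; positivity
  have hLw0 : 0 < Lw := by linarith
  have h1 : ℓ * (Real.pi / Lw) ≤ Real.pi / 2 := by
    rw [mul_div_assoc', div_le_div_iff₀ hLw0 (by norm_num)]; nlinarith [Real.pi_pos]
  calc ℓ * cΓ * (8 * κm * (Real.pi / Lw)) = 8 * cΓ * κm * (ℓ * (Real.pi / Lw)) := by ring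
    _ ≤ 8 * cΓ * (b * km * G * sL) * (Real.pi / 2) := by gcongr
    _ = κ * (4 * Real.pi * km) * (G / sL) := by
        rw [show 8 * cΓ * (b * km * G * sL) * (Real.pi / 2) = (cΓ * b) * (4 * Real.pi * km) * G * sL by ring, hcb, ← hsLL]
        first | (field_simp; ring) | field_simp
    _ ≤ κ * (4 * Real.pi * km) * (u / sL) := mul_le_mul_of_nonneg_left (ratio_bounds hG.le hGu hsL1).2.2 (by positivity)

/-- Term 8′ (Rosenhead-coefficient mismatch): `ℓ·cΓ(e²/R²)H ≤ κ·Rb hH e²/r₀² · u/sL` (`H = b hH`, `R = r₀G`, `1 ≤ G ≤ u`). [folklore] -/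
theorem selfDerivTerm_T8 {R H e r₀ hH : ℝ} (hcb : cΓ * b = κ / L) (hsLL : sL ^ 2 = L) (hsL1 : 1 ≤ sL) (hG1 : 1 ≤ G) (hGu : G ≤ u)
    (hκ : 0 ≤ κ) (hhH : 0 ≤ hH) (hRb : 0 ≤ Rb) (hr₀ : 0 < r₀) (hℓ : ℓ = Rb * G * sL) (hR : R = r₀ * G) (hHd : H = b * hH) :
    ℓ * (cΓ * (e ^ 2 / R ^ 2) * H) ≤ κ * (Rb * hH * e ^ 2 / r₀ ^ 2) * (u / sL) := by
  have hL0 : 0 < L := by rw [← hsLL]; positivity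
  have hsL0 : 0 < sL := by linarith
  have hG : 0 < G := by linarith
  have heq : ℓ * (cΓ * (e ^ 2 / R ^ 2) * H) = κ * (Rb * hH * e ^ 2 / r₀ ^ 2) * (1 / (G * sL)) := by
    rw [hℓ, hR, hHd, show Rb * G * sL * (cΓ * (e ^ 2 / (r₀ * G) ^ 2) * (b * hH)) = (cΓ * b) * (Rb * hH * e ^ 2) * G * sL / (r₀ * G) ^ 2 by ring,
      hcb, ← hsLL]
    first | (field_simp; ring) | field_simp
  rw [heq]
  refine mul_le_mul_of_nonneg_left ?_ (by positivity)
  rw [div_le_div_iff₀ (by positivity) hsL0]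
  have hu1 : 1 ≤ u := hG1.trans hGu
  nlinarith [mul_le_mul hG1 hu1 zero_le_one hG.le, hsL0]

end Summit.NavierStokesRegularity.NavierStokesRegularity.Theorems.SkeletonJ1RFrame

end
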